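import Literature.Analysis.ODE.RegularLevelCurvesFlowBox
import Literature.Topology.FourManifolds.WhitneyCircleIsotopy
import Literature.Topology.FourManifolds.CircleLoops
import HarnessLib

/-!
# Regular compact level curves in the plane are embedded circles

Topic `Literature/Topology/FourManifolds`; the one-dimensional input of the exp-height line of the
fact seat `provefact-Literature.Topology.FourManifolds.SphereEmbedding.schoenflies_exists_ball`
(Alexander's theorem, Schultens (2014), Thm. 3.2.5).  **Everything in this file is proved; no
definitions, no named facts.**

Alexander's argument works with the level circles `S ∩ {z = a}` of the height on the sphere and
with the planar discs they bound (Schultens (2014), PDF pp. 44–45: "a finite collection of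
circles", "a disk `D ⊂ H'` that meets `S` only in `a`").  On the level of a compact regular
domain `A = {F ≤ 0}` these are the regular level curves of `F` restricted to the level planes;
to feed them to the tree's two-dimensional Schoenflies theorem (`SchoenfliesSphereTwoHolds.lean`,
which consumes `SphereEmbedding 1 2`) they must be presented as smoothly embedded circles.  This
file does that:

* `PlanarLevelCircle.exists_levelCurveData` — a smooth `f : ℝ² → ℝ` with `Df ≠ 0` on `f⁻¹(0)`
  gives Khovanskii level-curve data (`Literature.Analysis.ODE.LevelCurveData 1`,
  `RegularLevelCurves.lean`) in the coordinates `ℝ² ≅ Fin 2 → ℝ`, with the rotated gradient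
  `(-∂₁f, ∂₀f)` as tangent field; `contDiff_traj_of_contDiff` — its trajectories are `C^∞`.
* `PlanarLevelCircle.exists_isSmoothEmbedding_range_subset` — **a compact, relatively open part
  `Γ₀` of a regular zero set `f⁻¹(0)` contains, through each of its points, the range of a smooth
  embedding `S : S¹ → ℝ²` which is itself relatively open in `f⁻¹(0)`** (so: the component).
  Proof: the trajectory through the point stays in `Γ₀` (clopen), hence is bounded, hence — as
  injective trajectories are proper (`tendsto_norm_traj_atTop`, `RegularLevelCurvesFlowBox.lean`)
  — periodic (`injective_or_periodic`); rescaled to period `2π` it descends along `circlePoint`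
  (`CircleLoops.lean`) to a loop with nowhere-zero θ-velocity and injective stage, which is a
  smooth embedding (`isSmoothEmbedding_stage`, `WhitneyCircleIsotopy.lean`); the flow box makes
  the range relatively open.

## References

* J. Schultens, *Introduction to 3-Manifolds*, GSM 151 (2014), proof of Thm. 3.2.5
  (PDF pp. 44–45). [Schultens2014]
* A. G. Khovanskii, *Fewnomials*, Transl. Math. Monogr. 88 (1991), Ch. III (phase curves of a
  non-vanishing field are lines or circles). [Khovanskii1991]
* J. Milnor, *Topology from the Differentiable Viewpoint* (1965), Appendix (classification of
  one-manifolds). [MilnorTDV1965]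
-/

open scoped RealInnerProductSpace Topology Manifold ContDiff
open Set Filter Metric Function Literature.Analysis.ODE

noncomputable section

namespace Literature.Topology.FourManifolds

namespace PlanarLevelCircle

/-! ### §1 The level-curve data of a planar function -/

/-- **The level-curve data of a smooth planar function with regular zero set**: in the
coordinates `ℝ² ≅ Fin 2 → ℝ` (`EuclideanSpace.equiv`), `H = f`, and the tangent field is the
rotated gradient `v = (-∂₁f, ∂₀f)` (Khovanskii's model for `d = 1`). [folklore] -/
theorem exists_levelCurveData {f : EuclideanSpace ℝ (Fin 2) → ℝ} (hf : ContDiff ℝ ∞ f)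
    (hreg : ∀ p, f p = 0 → fderiv ℝ f p ≠ 0) :
    ∃ D : LevelCurveData 1,
      (∀ z, D.H z = fun _ => f ((EuclideanSpace.equiv (Fin 2) ℝ).symm z)) ∧
      (∀ z, D.v z = ![-(fderiv ℝ f ((EuclideanSpace.equiv (Fin 2) ℝ).symm z) (EuclideanSpace.single 1 1)),
        fderiv ℝ f ((EuclideanSpace.equiv (Fin 2) ℝ).symm z) (EuclideanSpace.single 0 1)]) ∧
      ContDiff ℝ ∞ D.v := by
  set L := EuclideanSpace.equiv (Fin 2) ℝ with hL
  set H : (Fin 2 → ℝ) → (Fin 1 → ℝ) := fun z _ => f (L.symm z) with hH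
  set v : (Fin 2 → ℝ) → (Fin 2 → ℝ) := fun z =>
    ![-(fderiv ℝ f (L.symm z) (EuclideanSpace.single 1 1)),
      fderiv ℝ f (L.symm z) (EuclideanSpace.single 0 1)] with hv
  have hfL : ContDiff ℝ ∞ fun z : Fin 2 → ℝ => f (L.symm z) := hf.comp L.symm.contDiff
  have hHs : ContDiff ℝ ∞ H := contDiff_pi.2 fun _ => hfL
  have hDf : ContDiff ℝ ∞ fun z : Fin 2 → ℝ => fderiv ℝ f (L.symm z) :=
    (hf.fderiv_right (m := ∞) le_rfl).comp L.symm.contDiff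
  have hvs : ContDiff ℝ ∞ v := by
    refine contDiff_pi.2 fun i => ?_
    fin_cases i
    · exact ((ContinuousLinearMap.apply ℝ ℝ (EuclideanSpace.single 1 1)).contDiff.comp hDf).neg
    · exact (ContinuousLinearMap.apply ℝ ℝ (EuclideanSpace.single 0 1)).contDiff.comp hDf
  -- the derivative of `H`
  have hHd : ∀ z w, fderiv ℝ H z w = fun _ => fderiv ℝ f (L.symm z) (L.symm w) := by
    intro z w
    have h1 : HasFDerivAt (fun z : Fin 2 → ℝ => f (L.symm z))
        ((fderiv ℝ f (L.symm z)).comp (L.symm : (Fin 2 → ℝ) →L[ℝ] EuclideanSpace ℝ (Fin 2))) z :=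
      ((hf.differentiable (by simp)) _).hasFDerivAt.comp z L.symm.hasFDerivAt
    have h2 : HasFDerivAt H (ContinuousLinearMap.pi fun _ : Fin 1 =>
        (fderiv ℝ f (L.symm z)).comp (L.symm : (Fin 2 → ℝ) →L[ℝ] EuclideanSpace ℝ (Fin 2))) z :=
      hasFDerivAt_pi.2 fun _ => h1
    rw [h2.fderiv]
    rfl
  -- `L.symm w` in terms of the basis
  have hLsymm : ∀ w : Fin 2 → ℝ, L.symm w =
      w 0 • EuclideanSpace.single 0 (1 : ℝ) + w 1 • EuclideanSpace.single 1 (1 : ℝ) := by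
    intro w
    ext i
    fin_cases i <;> simp [hL]
  refine ⟨⟨H, v, hHs.of_le (by norm_cast), hvs.of_le (by norm_cast), fun z => ?_, fun z hz => ?_,
    fun z hz => ?_⟩, fun z => rfl, fun z => rfl, hvs⟩
  · -- tangency: `dH(v) = -∂₁f ∂₀f + ∂₀f ∂₁f = 0`
    ext i
    rw [hHd]
    simp only [Pi.zero_apply]
    rw [hLsymm (v z), map_add, map_smul, map_smul]
    simp only [hv, Matrix.cons_val_zero, Matrix.cons_val_one, smul_eq_mul]
    ring
  · -- `v ≠ 0` on the zero set
    intro hv0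
    have hz0 : f (L.symm z) = 0 := by
      have := congrFun hz 0; simpa [hH] using this
    apply hreg _ hz0
    have h0 : fderiv ℝ f (L.symm z) (EuclideanSpace.single 0 1) = 0 := by
      have := congrFun hv0 1; simpa [hv] using this
    have h1 : fderiv ℝ f (L.symm z) (EuclideanSpace.single 1 1) = 0 := by
      have := congrFun hv0 0; simpa [hv] using this
    ext w
    have hw : w = w 0 • EuclideanSpace.single 0 (1 : ℝ) + w 1 • EuclideanSpace.single 1 (1 : ℝ) := by
      ext i; fin_cases i <;> simp
    rw [hw, map_add, map_smul, map_smul, h0, h1]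
    simp
  · -- surjectivity of `dH` on the zero set
    have hz0 : f (L.symm z) = 0 := by
      have := congrFun hz 0; simpa [hH] using this
    have hne := hreg _ hz0
    -- some basis vector has nonzero derivative
    obtain ⟨w₀, hw₀⟩ : ∃ w₀ : Fin 2 → ℝ, fderiv ℝ f (L.symm z) (L.symm w₀) ≠ 0 := by
      by_contra h
      push Not at h
      apply hne
      ext w
      have := h (L w)
      rw [L.symm_apply_apply] at this
      simpa using this
    intro c
    refine ⟨(c 0 / fderiv ℝ f (L.symm z) (L.symm w₀)) • w₀, ?_⟩
    ext i
    rw [hHd]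
    have hi : i = 0 := Subsingleton.elim _ _
    subst hi
    simp only [map_smul, smul_eq_mul]
    field_simp

/-! ### §2 Smooth trajectories -/

/-- For a level-curve datum with `C^∞` defining map and tangent field, the renormalised field is
`C^∞`. [folklore] -/
theorem contDiff_field_of_contDiff {d : ℕ} (D : LevelCurveData d) (hv : ContDiff ℝ ∞ D.v) :
    ContDiff ℝ ∞ D.field := by
  have hnf : ContDiff ℝ ∞ D.nf := by
    refine ContDiff.inv ?_ fun z => (D.one_add_sum_sq_pos z).ne'
    exact contDiff_const.add (ContDiff.sum fun j _ => ((contDiff_apply ℝ ℝ j).comp hv).pow 2)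
  exact hnf.smul hv

/-- **Trajectories of a `C^∞` level-curve datum are `C^∞`** (bootstrapping `γ' = w ∘ γ`).
[folklore] -/
theorem contDiff_traj_of_contDiff {d : ℕ} (D : LevelCurveData d) (hv : ContDiff ℝ ∞ D.v)
    (z : Fin (d + 1) → ℝ) : ContDiff ℝ ∞ (D.traj z) := by
  have hw := contDiff_field_of_contDiff D hv
  have hderiv : deriv (D.traj z) = fun t => D.field (D.traj z t) :=
    funext fun t => (D.hasDerivAt_traj z t).deriv
  have hdiff : Differentiable ℝ (D.traj z) := fun t => (D.hasDerivAt_traj z t).differentiableAt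
  suffices h : ∀ n : ℕ, ContDiff ℝ n (D.traj z) from contDiff_infty.2 h
  intro n
  induction n with
  | zero => exact contDiff_zero.2 (D.continuous_traj z)
  | succ n ih =>
    rw [show ((n + 1 : ℕ) : WithTop ℕ∞) = (n : WithTop ℕ∞) + 1 by push_cast; rfl,
      contDiff_succ_iff_deriv]
    refine ⟨hdiff, fun h => absurd h (by simp), ?_⟩
    rw [hderiv]
    exact (hw.of_le (by norm_cast; exact le_top)).comp ih

/-! ### §3 The embedded circle -/

/-- **A regular compact planar level curve is an embedded circle.**  Let `f : ℝ² → ℝ` be smooth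
with `Df ≠ 0` on `f⁻¹(0)`, and let `Γ₀` be a compact, relatively open part of `f⁻¹(0)` (a union
of components) containing `p₀`.  Then there is a smooth embedding `S : S¹ → ℝ²` through `p₀`
whose range lies in `Γ₀` and is itself relatively open in `f⁻¹(0)` (so it is the component of
`p₀`).  Proof: the trajectory of the rotated gradient through `p₀` (Khovanskii's level-curve
data, `Literature/Analysis/ODE/RegularLevelCurves*.lean`) stays in `Γ₀`, hence is bounded, hence
periodic (injective trajectories are proper); rescaled to period `2π` it descends along
`circlePoint` to a loop with nowhere-zero velocity and injective stage, i.e. a smooth embedding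
(`isSmoothEmbedding_stage`); the flow box makes its range relatively open. [folklore] -/
theorem exists_isSmoothEmbedding_range_subset {f : EuclideanSpace ℝ (Fin 2) → ℝ}
    (hf : ContDiff ℝ ∞ f) (hreg : ∀ p, f p = 0 → fderiv ℝ f p ≠ 0)
    {Γ₀ U : Set (EuclideanSpace ℝ (Fin 2))} (hΓc : IsCompact Γ₀) (hU : IsOpen U)
    (hΓ : f ⁻¹' {0} ∩ U = Γ₀) {p₀ : EuclideanSpace ℝ (Fin 2)} (hp₀ : p₀ ∈ Γ₀) :
    ∃ S : (sphere (0 : EuclideanSpace ℝ (Fin 2)) 1) → EuclideanSpace ℝ (Fin 2),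
      Manifold.IsSmoothEmbedding (𝓡 1) (𝓡 2) ∞ S ∧ p₀ ∈ range S ∧ range S ⊆ Γ₀ ∧
      ∃ V : Set (EuclideanSpace ℝ (Fin 2)), IsOpen V ∧ f ⁻¹' {0} ∩ V = range S := by
  obtain ⟨D, hDH, hDv, hvs⟩ := exists_levelCurveData hf hreg
  set L := EuclideanSpace.equiv (Fin 2) ℝ with hL
  have hcurve : ∀ z, z ∈ D.curve ↔ f (L.symm z) = 0 := by
    intro z
    rw [LevelCurveData.mem_curve, hDH]
    constructor
    · intro h; have := congrFun h 0; simpa using this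
    · intro h; ext; simp [h]
  have hΓsub : Γ₀ ⊆ f ⁻¹' {0} := fun p hp => by rw [← hΓ] at hp; exact hp.1
  set z₀ := L p₀ with hz₀
  have hz₀c : z₀ ∈ D.curve := by
    rw [hcurve, hz₀, L.symm_apply_apply]; exact hΓsub hp₀
  set γ : ℝ → Fin 2 → ℝ := D.traj z₀ with hγ
  have hγc : ∀ t, γ t ∈ D.curve := fun t => D.traj_mem_curve hz₀c t
  have hγcont : Continuous γ := D.continuous_traj z₀
  have hγs : ContDiff ℝ ∞ γ := contDiff_traj_of_contDiff D hvs z₀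
  -- the trajectory stays in `Γ₀`
  have hstay : ∀ t, L.symm (γ t) ∈ Γ₀ := by
    have hclopen : IsClopen {t : ℝ | L.symm (γ t) ∈ Γ₀} := by
      refine ⟨hΓc.isClosed.preimage (L.symm.continuous.comp hγcont), ?_⟩
      rw [isOpen_iff_mem_nhds]
      intro t ht
      have hU' : ∀ᶠ s in 𝓝 t, L.symm (γ s) ∈ U := by
        have : L.symm (γ t) ∈ U := by rw [← hΓ] at ht; exact ht.2
        exact (L.symm.continuous.comp hγcont).continuousAt.preimage_mem_nhds (hU.mem_nhds this)
      filter_upwards [hU'] with s hs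
      show L.symm (γ s) ∈ Γ₀
      rw [← hΓ]
      exact ⟨(hcurve _).1 (hγc s), hs⟩
    have huniv := hclopen.eq_univ ⟨0, by
      show L.symm (γ 0) ∈ Γ₀
      rw [hγ, D.traj_zero, hz₀, L.symm_apply_apply]; exact hp₀⟩
    intro t
    have : t ∈ {t : ℝ | L.symm (γ t) ∈ Γ₀} := by rw [huniv]; trivial
    exact this
  -- hence bounded, hence not injective, hence periodic
  obtain ⟨R, hR⟩ : ∃ R, ∀ t, ‖γ t‖ ≤ R := by
    obtain ⟨R, hR⟩ := (hΓc.image L.continuous).isBounded.subset_closedBall_lt 0 0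
    refine ⟨R, fun t => ?_⟩
    have : γ t ∈ L '' Γ₀ := ⟨L.symm (γ t), hstay t, L.apply_symm_apply _⟩
    simpa using hR.2 this
  obtain ⟨T, hT, hper, hinjOn⟩ : ∃ T > 0, (∀ t, γ (t + T) = γ t) ∧
      ∀ a, InjOn γ (Ico a (a + T)) := by
    rcases D.injective_or_periodic hz₀c with hinj | hper
    · exfalso
      have h := D.tendsto_norm_traj_atTop hz₀c hinj
      obtain ⟨t, ht⟩ := (tendsto_atTop.1 h (R + 1)).exists
      linarith [hR t]
    · exact hper
  -- the `2π`-periodic rescaled curve in the plane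
  set c : ℝ := T / (2 * Real.pi) with hc
  have hcpos : 0 < c := by positivity
  set P : ℝ → EuclideanSpace ℝ (Fin 2) := fun θ => L.symm (γ (c * θ)) with hP
  have hPper : Periodic P (2 * Real.pi) := by
    intro θ
    simp only [hP]
    rw [show c * (θ + 2 * Real.pi) = c * θ + T by rw [hc]; field_simp, hper]
  have hPs : ContDiff ℝ ∞ P := L.symm.contDiff.comp (hγs.comp (contDiff_const.mul contDiff_id))
  have hPd : ∀ θ, HasDerivAt P (c • L.symm (D.field (γ (c * θ)))) θ := by
    intro θ
    have h1 : HasDerivAt (fun θ : ℝ => γ (c * θ)) (c • D.field (γ (c * θ))) θ :=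
      ((D.hasDerivAt_traj z₀ (c * θ)).scomp θ ((hasDerivAt_id θ).const_mul c)).congr_deriv
        (by simp [hγ])
    have h2 := (L.symm : (Fin 2 → ℝ) →L[ℝ] EuclideanSpace ℝ (Fin 2)).hasFDerivAt.comp_hasDerivAt θ h1
    exact h2.congr_deriv (by simp)
  have hPd_ne : ∀ θ, c • L.symm (D.field (γ (c * θ))) ≠ 0 := by
    intro θ
    rw [smul_ne_zero_iff]
    refine ⟨hcpos.ne', fun h => D.field_ne_zero (hγc (c * θ)) ?_⟩
    exact L.symm.injective (by rw [h, map_zero])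
  -- injectivity modulo the period
  have hPinj : ∀ θ θ', P θ = P θ' → ∃ k : ℤ, θ' = θ + 2 * Real.pi * k := by
    intro θ θ' h
    have h1 : γ (c * θ) = γ (c * θ') := L.symm.injective h
    -- reduce `c θ'` into the window `[c θ, c θ + T)`
    obtain ⟨k, hk1, hk2⟩ : ∃ k : ℤ, c * θ ≤ c * θ' - k * T ∧ c * θ' - k * T < c * θ + T := by
      refine ⟨⌊(c * θ' - c * θ) / T⌋, ?_, ?_⟩
      · have := Int.floor_le ((c * θ' - c * θ) / T)
        rw [le_div_iff₀ hT] at this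
        linarith
      · have := Int.lt_floor_add_one ((c * θ' - c * θ) / T)
        rw [div_lt_iff₀ hT, add_mul, one_mul] at this; linarith
    have hperk : ∀ (n : ℤ) (t : ℝ), γ (t - n * T) = γ t := by
      intro n t
      have hp : Periodic γ T := hper
      have := hp.sub_int_mul_eq n (x := t)
      simpa [mul_comm] using this
    have h2 : γ (c * θ' - k * T) = γ (c * θ) := by rw [hperk, h1]
    have h3 : c * θ' - k * T = c * θ :=
      hinjOn (c * θ) ⟨hk1, hk2⟩ ⟨le_rfl, by linarith⟩ h2
    refine ⟨k, ?_⟩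
    rw [hc] at h3
    field_simp at h3
    linarith
  -- descend to the circle
  obtain ⟨S₀, hS₀⟩ := exists_fun_comp_circlePoint_eq hPper
  have hcomp : S₀ ∘ circlePoint = P := funext hS₀
  have hS₀s : ContMDiff (𝓡 1) (𝓡 2) ∞ S₀ := by
    intro u
    obtain ⟨θ, rfl⟩ := circlePoint_surjective u
    refine contMDiffAt_of_comp_circlePoint ?_
    rw [hcomp]
    exact hPs.contMDiff.contMDiffAt
  set G : ℝ × (sphere (0 : EuclideanSpace ℝ (Fin 2)) 1) → EuclideanSpace ℝ (Fin 2) := fun q => S₀ q.2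
    with hG
  have hGs : ContMDiff (𝓘(ℝ, ℝ).prod (𝓡 1)) (𝓡 2) ∞ G := hS₀s.comp contMDiff_snd
  have hgood : StagesGoodOn 2 G univ := by
    refine ⟨fun t s _ => ?_, fun t u u' _ huu' => ?_⟩
    · -- nonzero velocity
      have hfinj : Injective (fderiv ℝ P s) := by
        rw [(hPd s).hasFDerivAt.fderiv]
        intro a b hab
        have : a • (c • L.symm (D.field (γ (c * s)))) = b • (c • L.symm (D.field (γ (c * s)))) := by
          simpa using hab
        exact smul_left_injective ℝ (hPd_ne s) this
      have hinj : Injective (mfderiv 𝓘(ℝ, ℝ) (𝓡 2) P (s - 0)) := by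
        rw [sub_zero, show mfderiv 𝓘(ℝ, ℝ) (𝓡 2) P s = fderiv ℝ P s from mfderiv_eq_fderiv]
        exact hfinj
      have heq : (S₀ ∘ circlePoint) =ᶠ[𝓝 s] fun r => P (r - 0) :=
        Filter.Eventually.of_forall fun r => by
          show S₀ (circlePoint r) = P (r - 0)
          rw [sub_zero]; exact hS₀ r
      exact thetaVel_const_ne_zero_of_eventuallyEq_curve hPs.contMDiff hinj heq
    · -- injective stage
      obtain ⟨θ, rfl⟩ := circlePoint_surjective u
      obtain ⟨θ', rfl⟩ := circlePoint_surjective u'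
      have h : P θ = P θ' := by rw [← hS₀ θ, ← hS₀ θ']; exact huu'
      obtain ⟨k, hk⟩ := hPinj θ θ' h
      rw [hk, show θ + 2 * Real.pi * k = θ + k * (2 * Real.pi) by ring]
      exact (periodic_circlePoint.int_mul k θ).symm
  have hemb : Manifold.IsSmoothEmbedding (𝓡 1) (𝓡 2) ∞ S₀ := isSmoothEmbedding_stage hGs hgood 0
  -- the range
  have hrange : range S₀ = range P := by
    ext q
    constructor
    · rintro ⟨u, rfl⟩
      obtain ⟨θ, rfl⟩ := circlePoint_surjective u
      exact ⟨θ, (hS₀ θ).symm⟩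
    · rintro ⟨θ, rfl⟩
      exact ⟨circlePoint θ, hS₀ θ⟩
  have hrangeP : range P = (fun t => L.symm (γ t)) '' univ := by
    ext q
    simp only [hP, mem_range, image_univ]
    constructor
    · rintro ⟨θ, rfl⟩; exact ⟨c * θ, rfl⟩
    · rintro ⟨t, rfl⟩; exact ⟨t / c, by rw [mul_div_cancel₀ _ hcpos.ne']⟩
  refine ⟨S₀, hemb, ?_, ?_, ?_⟩
  · rw [hrange]
    refine ⟨0, ?_⟩
    simp only [hP, mul_zero]
    rw [hγ, D.traj_zero, hz₀, L.symm_apply_apply]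
  · rw [hrange, hrangeP, image_univ]
    rintro q ⟨t, rfl⟩
    exact hstay t
  · -- relatively open, by the flow box along the trajectory
    have hloc : ∀ t, ∃ W : Set (EuclideanSpace ℝ (Fin 2)), IsOpen W ∧ L.symm (γ t) ∈ W ∧
        f ⁻¹' {0} ∩ W ⊆ range P := by
      intro t
      obtain ⟨Uz, hUz, hsub⟩ := D.exists_nhds_curve_inter_subset_traj (hγc t)
      obtain ⟨W', hW'sub, hW'o, hW'mem⟩ := _root_.mem_nhds_iff.1 hUz
      refine ⟨L.symm '' W', ?_, ⟨γ t, hW'mem, rfl⟩, ?_⟩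
      · exact L.symm.toHomeomorph.isOpenMap _ hW'o
      · rintro q ⟨hq0, ⟨w, hw, rfl⟩⟩
        have hwc : w ∈ D.curve := (hcurve w).2 hq0
        obtain ⟨r, -, hr⟩ := hsub ⟨hwc, hW'sub hw⟩
        rw [hrangeP, image_univ]
        refine ⟨t + r, ?_⟩
        show L.symm (γ (t + r)) = L.symm w
        rw [hγ, D.traj_add, ← hγ]
        exact congrArg _ hr
    choose W hWo hWmem hWsub using hloc
    refine ⟨⋃ t, W t, isOpen_iUnion hWo, ?_⟩
    rw [hrange]
    ext q
    constructor
    · rintro ⟨hq0, hq⟩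
      obtain ⟨t, ht⟩ := mem_iUnion.1 hq
      exact hWsub t ⟨hq0, ht⟩
    · intro hq
      refine ⟨?_, ?_⟩
      · rw [hrangeP, image_univ] at hq
        obtain ⟨t, rfl⟩ := hq
        exact (hcurve _).1 (hγc t)
      · rw [hrangeP, image_univ] at hq
        obtain ⟨t, rfl⟩ := hq
        exact mem_iUnion.2 ⟨t, hWmem t⟩

end PlanarLevelCircle

end Literature.Topology.FourManifolds

end
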